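import Mathlib
import HarnessLib
import Summits.ValiantsHypothesis.ValiantsHypothesis.Theorems.MonotoneRestorationOrbitRestorationQPDepthThreeRungDefs

/-!
# The symmetric-input obstruction for the kill instruments of the route: matrix-symmetric polynomials cannot separate graphs with
# isomorphic bipartite splittings — worked pair `2·C₃` vs `C₆`
(crux `OrbitRestorationQP`, stmt-ValiantsHypothesis-18293 — and the cruxes `NonnegRestorationQP` (16191), `MonotoneRestorationQP`
(15886): all three kill glues go through a SEPARATING PAIR of simple graphs)

Namespace `Summit.ValiantsHypothesis.ValiantsHypothesis.Theorems.OrbitRestorationQPDepthThreeRung.BipartiteSplitting`.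
Definition-free.

Every refutation instrument of the route (`RungKill.restorationOn_false_of_separating`, `…sigmaPiSigmaValue_false_of_separating`,
`orbitRestorationQP_false_of_polylogWidthVP`, the Dawar–Wilsenach pipeline `not_qpOrbitSymmetric_of_polylogSeparating`) asks for
a MATRIX-SYMMETRIC family `f` (invariant under INDEPENDENT row and column permutations) and, beyond every order, two
`C^k`-equivalent simple graphs `X`, `Y` on `Fin m` whose `0/1` ADJACENCY matrices get different values of `f m`.  Evaluating a
matrix-symmetric polynomial at the adjacency matrix of `X` only sees the BIPARTITE SPLITTING of `X` (rows `= V(X) × {0}`, columns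
`= V(X) × {1}`, `(i,0) ~ (j,1)` iff `X.Adj i j` — the bipartite double cover `X × K₂` with its two sides remembered up to
independent relabelling).  We record the resulting constraint on witnesses, which is strictly stronger than non-isomorphism:

* `eval_eq_of_aligned` — the core identity: if two input matrices `A`, `B : Fin m × Fin m → R` are ALIGNED by a pair of
  permutations, `A (σ i, τ j) = B (i, j)`, then every matrix-symmetric `p` has `eval A p = eval B p` (`eval_rename`);
* `eval_indicator_eq_of_adj_iff` — graphs: `X.Adj (σ i) (τ j) ↔ Y.Adj i j` for some `σ, τ` forces equal values on the adjacency
  matrices; `no_alignment_of_eval_ne` — **contrapositive: a separating pair for a matrix-symmetric polynomial admits NO alignment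
  (its bipartite splittings are non-isomorphic as bipartite graphs with marked sides)**;
* `twoTriangles_hexagon_aligned` — the explicit alignment `σ = (0 2 4 1 3 5)`, `τ = (3 5 1 4 0 2)` (one-line notation) of the
  disjoint union of two triangles `2·C₃` (`fromRel (i/3 = j/3)` on `Fin 6`) with the hexagon `C₆` (`cycleGraph 6`): both have the
  bipartite splitting `2·C₆`;
* `eval_twoTriangles_eq_eval_hexagon` — **hence NO matrix-symmetric polynomial at level `6`, over any commutative semiring,
  distinguishes the adjacency matrices of `2·C₃` and `C₆`**, although the two graphs are not isomorphic
  (`not_iso_twoTriangles_hexagon`: one has a triangle, the other is triangle-free) and are separated already by the triangle count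
  `hom(K₃, ·)` (three pebbles).  So the counting-width currency of the kill instruments is COARSER on symmetric inputs than graph
  `C^k`-equivalence: the usable witnesses are pairs whose bipartite double covers differ (for Cai–Fürer–Immerman pairs over a
  connected NON-bipartite base graph the double covers are CFI graphs over the double cover of the base with an even twist, hence
  isomorphic — such pairs are useless here; over bipartite bases the double cover is two copies and the twist parity survives.
  This remark is informal; only the alignment lemma and the worked pair are certified).

Honest label: a constraint on refutation witnesses (bookkeeping for refuters of 18293/16191/15886) with one certified example; no
stub closed; VP ≠ VNP untouched. [folklore; cite: DawarWilsenach2025, §6–§7 (supports and the bipartite evaluation);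
CaiFurerImmerman1992, §6 (the CFI construction)]
-/

noncomputable section

open scoped Classical

-- `Summit.ValiantsHypothesis.ValiantsHypothesis.…` is the tree's single-conjunct layout (Sub = Summit).
set_option linter.dupNamespace false

namespace Summit.ValiantsHypothesis.ValiantsHypothesis.Theorems.OrbitRestorationQPDepthThreeRung.BipartiteSplitting

open MvPolynomial Equiv

/-! ### Aligned inputs give equal values -/

/-- **Aligned input matrices are not separated.**  If `p` is invariant under independent row and column permutations and the
matrices `A`, `B` satisfy `A (σ i, τ j) = B (i, j)` for a pair of permutations `σ, τ`, then `eval A p = eval B p`. [folklore] -/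
theorem eval_eq_of_aligned {m : ℕ} {R : Type*} [CommSemiring R] (p : MvPolynomial (Fin m × Fin m) R)
    (hp : ∀ σ τ : Perm (Fin m), rename (fun q : Fin m × Fin m => (σ q.1, τ q.2)) p = p)
    (A B : Fin m × Fin m → R) (σ τ : Perm (Fin m)) (hAB : ∀ i j, A (σ i, τ j) = B (i, j)) :
    eval A p = eval B p := by
  have hfun : (A ∘ fun q : Fin m × Fin m => (σ q.1, τ q.2)) = B := funext fun q => by simpa using hAB q.1 q.2
  conv_lhs => rw [← hp σ τ]
  rw [eval_rename, hfun]

/-- Graph form: if `X.Adj (σ i) (τ j) ↔ Y.Adj i j` for some permutations `σ, τ` (the bipartite splittings of `X` and `Y` are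
isomorphic as bipartite graphs with marked sides), then every matrix-symmetric `p` takes the same value on the two adjacency
matrices. [folklore] -/
theorem eval_indicator_eq_of_adj_iff {m : ℕ} {R : Type*} [CommSemiring R] (p : MvPolynomial (Fin m × Fin m) R)
    (hp : ∀ σ τ : Perm (Fin m), rename (fun q : Fin m × Fin m => (σ q.1, τ q.2)) p = p)
    (X Y : SimpleGraph (Fin m)) (σ τ : Perm (Fin m)) (h : ∀ i j, X.Adj (σ i) (τ j) ↔ Y.Adj i j) :
    eval (Set.indicator {ij : Fin m × Fin m | X.Adj ij.1 ij.2} 1) p =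
      eval (Set.indicator {ij : Fin m × Fin m | Y.Adj ij.1 ij.2} 1) p := by
  refine eval_eq_of_aligned p hp _ _ σ τ fun i j => ?_
  by_cases hY : Y.Adj i j
  · have hX : X.Adj (σ i) (τ j) := (h i j).2 hY
    rw [Set.indicator_of_mem (show ((σ i, τ j) : Fin m × Fin m) ∈ {ij : Fin m × Fin m | X.Adj ij.1 ij.2} from hX),
      Set.indicator_of_mem (show ((i, j) : Fin m × Fin m) ∈ {ij : Fin m × Fin m | Y.Adj ij.1 ij.2} from hY)]
    rfl
  · have hX : ¬ X.Adj (σ i) (τ j) := fun hX => hY ((h i j).1 hX)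
    rw [Set.indicator_of_notMem (show ((σ i, τ j) : Fin m × Fin m) ∉ {ij : Fin m × Fin m | X.Adj ij.1 ij.2} from hX),
      Set.indicator_of_notMem (show ((i, j) : Fin m × Fin m) ∉ {ij : Fin m × Fin m | Y.Adj ij.1 ij.2} from hY)]

/-- **A separating pair admits no alignment.**  If a matrix-symmetric `p` takes different values on the adjacency matrices of
`X` and `Y`, then no pair of permutations aligns the two adjacency relations — the bipartite splittings (double covers with marked
sides) of `X` and `Y` are non-isomorphic; in particular `X ≇ Y`. [folklore] -/
theorem no_alignment_of_eval_ne {m : ℕ} {R : Type*} [CommSemiring R] (p : MvPolynomial (Fin m × Fin m) R)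
    (hp : ∀ σ τ : Perm (Fin m), rename (fun q : Fin m × Fin m => (σ q.1, τ q.2)) p = p)
    (X Y : SimpleGraph (Fin m))
    (hne : eval (Set.indicator {ij : Fin m × Fin m | X.Adj ij.1 ij.2} 1) p ≠
      eval (Set.indicator {ij : Fin m × Fin m | Y.Adj ij.1 ij.2} 1) p) :
    ¬ ∃ σ τ : Perm (Fin m), ∀ i j, X.Adj (σ i) (τ j) ↔ Y.Adj i j := by
  rintro ⟨σ, τ, h⟩
  exact hne (eval_indicator_eq_of_adj_iff p hp X Y σ τ h)

/-- In particular a separating pair is never a pair of isomorphic graphs (the alignment `σ = τ =` the isomorphism). [folklore] -/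
theorem not_iso_of_eval_ne {m : ℕ} {R : Type*} [CommSemiring R] (p : MvPolynomial (Fin m × Fin m) R)
    (hp : ∀ σ τ : Perm (Fin m), rename (fun q : Fin m × Fin m => (σ q.1, τ q.2)) p = p)
    (X Y : SimpleGraph (Fin m))
    (hne : eval (Set.indicator {ij : Fin m × Fin m | X.Adj ij.1 ij.2} 1) p ≠
      eval (Set.indicator {ij : Fin m × Fin m | Y.Adj ij.1 ij.2} 1) p) :
    IsEmpty (Y ≃g X) := by
  refine ⟨fun e => no_alignment_of_eval_ne p hp X Y hne ⟨e.toEquiv, e.toEquiv, fun i j => ?_⟩⟩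
  exact e.map_adj_iff

/-- Family form, on the route's vocabulary: for a matrix-symmetric family `f` (`IsMatrixSymmetric`), at every level the two
adjacency evaluations agree on every aligned pair — so the separation clause of the kill instruments
(`RungKill.restorationOn_false_of_separating`, `not_qpOrbitSymmetric_of_polylogSeparating`) can only be met by pairs with
non-isomorphic bipartite splittings. [folklore] -/
theorem eval_indicator_eq_of_isMatrixSymmetric (f : (n : ℕ) → MvPolynomial (Fin n × Fin n) ℂ) (hf : IsMatrixSymmetric f)
    {m : ℕ} (X Y : SimpleGraph (Fin m)) (σ τ : Perm (Fin m)) (h : ∀ i j, X.Adj (σ i) (τ j) ↔ Y.Adj i j) :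
    eval (Set.indicator {ij : Fin m × Fin m | X.Adj ij.1 ij.2} 1) (f m) =
      eval (Set.indicator {ij : Fin m × Fin m | Y.Adj ij.1 ij.2} 1) (f m) :=
  eval_indicator_eq_of_adj_iff (f m) (hf m) X Y σ τ h

/-! ### The worked pair: two triangles versus the hexagon -/

/-- **`2·C₃` and `C₆` have isomorphic bipartite splittings.**  With the two triangles `{0,1,2}`, `{3,4,5}` (`fromRel (i/3 = j/3)`)
and the hexagon `cycleGraph 6`, the permutations `σ = (0 2 4 1 3 5)` (rows) and `τ = (3 5 1 4 0 2)` (columns), in one-line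
notation, satisfy `C₆.Adj (σ i) (τ j) ↔ (2·C₃).Adj i j`: the rows of the first triangle go to the even hexagon vertices and its
columns to the odd ones (and vice versa for the second triangle), and an even and an odd hexagon vertex are adjacent unless they
are antipodal. [folklore] -/
theorem twoTriangles_hexagon_aligned :
    ∃ σ τ : Perm (Fin 6), ∀ i j : Fin 6,
      (SimpleGraph.cycleGraph 6).Adj (σ i) (τ j) ↔
        (SimpleGraph.fromRel fun a b : Fin 6 => a.val / 3 = b.val / 3).Adj i j := by
  refine ⟨⟨![0, 2, 4, 1, 3, 5], ![0, 3, 1, 4, 2, 5], by decide, by decide⟩,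
    ⟨![3, 5, 1, 4, 0, 2], ![4, 2, 5, 0, 3, 1], by decide, by decide⟩, ?_⟩
  decide

/-- The two graphs are NOT isomorphic: `2·C₃` contains the triangle `{0,1,2}`, the hexagon is triangle-free. [folklore] -/
theorem not_iso_twoTriangles_hexagon :
    IsEmpty ((SimpleGraph.fromRel fun a b : Fin 6 => a.val / 3 = b.val / 3) ≃g SimpleGraph.cycleGraph 6) := by
  refine ⟨fun e => ?_⟩
  have hC : ∀ a b c : Fin 6, ¬ ((SimpleGraph.cycleGraph 6).Adj a b ∧ (SimpleGraph.cycleGraph 6).Adj b c ∧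
      (SimpleGraph.cycleGraph 6).Adj a c) := by
    decide
  have h01 : (SimpleGraph.fromRel fun a b : Fin 6 => a.val / 3 = b.val / 3).Adj 0 1 := by decide
  have h12 : (SimpleGraph.fromRel fun a b : Fin 6 => a.val / 3 = b.val / 3).Adj 1 2 := by decide
  have h02 : (SimpleGraph.fromRel fun a b : Fin 6 => a.val / 3 = b.val / 3).Adj 0 2 := by decide
  exact hC (e 0) (e 1) (e 2) ⟨e.map_adj_iff.2 h01, e.map_adj_iff.2 h12, e.map_adj_iff.2 h02⟩

/-- **NO MATRIX-SYMMETRIC POLYNOMIAL SEPARATES `2·C₃` FROM `C₆`.**  For every commutative semiring `R` and every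
`p ∈ R[x_ij : i,j<6]` invariant under independent row and column permutations, the values of `p` at the adjacency matrices of the
two triangles and of the hexagon coincide — although the graphs are non-isomorphic and are told apart by the triangle count
(a treewidth-`2` homomorphism count, three pebbles).  The pair is therefore unusable in every kill instrument of the route, and
so is any pair with isomorphic bipartite splittings. [folklore] -/
theorem eval_twoTriangles_eq_eval_hexagon {R : Type*} [CommSemiring R] (p : MvPolynomial (Fin 6 × Fin 6) R)
    (hp : ∀ σ τ : Perm (Fin 6), rename (fun q : Fin 6 × Fin 6 => (σ q.1, τ q.2)) p = p) :
    eval (Set.indicator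
        {ij : Fin 6 × Fin 6 | (SimpleGraph.fromRel fun a b : Fin 6 => a.val / 3 = b.val / 3).Adj ij.1 ij.2} 1) p =
      eval (Set.indicator {ij : Fin 6 × Fin 6 | (SimpleGraph.cycleGraph 6).Adj ij.1 ij.2} 1) p := by
  obtain ⟨σ, τ, h⟩ := twoTriangles_hexagon_aligned
  exact (eval_indicator_eq_of_adj_iff p hp _ _ σ τ h).symm

/-- The same for a matrix-symmetric FAMILY at level `6` (route vocabulary `IsMatrixSymmetric`). [folklore] -/
theorem eval_twoTriangles_eq_eval_hexagon_family (f : (n : ℕ) → MvPolynomial (Fin n × Fin n) ℂ)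
    (hf : IsMatrixSymmetric f) :
    eval (Set.indicator
        {ij : Fin 6 × Fin 6 | (SimpleGraph.fromRel fun a b : Fin 6 => a.val / 3 = b.val / 3).Adj ij.1 ij.2} 1) (f 6) =
      eval (Set.indicator {ij : Fin 6 × Fin 6 | (SimpleGraph.cycleGraph 6).Adj ij.1 ij.2} 1) (f 6) :=
  eval_twoTriangles_eq_eval_hexagon (f 6) (hf 6)

end Summit.ValiantsHypothesis.ValiantsHypothesis.Theorems.OrbitRestorationQPDepthThreeRung.BipartiteSplitting

end
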